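import Summits.Ventures.LatticeQCDFlow.Exactness.Phi4FlowSquareIntegrableSticking
import HarnessLib

/-!
# Reweight or accept/reject?  The exact flow sampler never beats self-normalised reweighting
# of the same model draws: `σ²_chain(g) ≥ σ²_RW(g)` for every square-integrable observable

HONEST FRAMING: exact (Metropolis-corrected) sampling algorithms for lattice gauge theory;
figures of merit are autocorrelation/cost numbers at stated couplings and volumes; no
continuum-physics claim.  (SCALAR calibration rung S0-A: not a gauge result.)

Venture `LatticeQCDFlow` (cell pub-lqcd), topic `Exactness`; FANOUT row 2 (`s0-phi4`, FLOW arm).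
NEW WORK of the cell in the tree's vocabulary; the printed counterpart is NAMED, nothing is cited
as a fact: Deligiannidis–Lee 2018 (Ann. Appl. Probab. 28), §3.2 "Comparison with self-normalized
importance sampling", Proposition: for the independence sampler `var(f, P) ≥ π(w·f̄²)`, the
limiting variance of the self-normalised importance-sampling (reweighting) estimator fed with the
SAME independent model draws.  The two estimators are the two published uses of a trained flow on
the lattice (accept/reject: Albergo–Kanwar–Shanahan 2019; reweighting: Nicoli et al. 2020 — named
only).  The tree already holds both halves of the route separately: the summed sticking floor
`τ_int(g) ≥ ½ + E_{g²}[r/(1 − r)]` on `L²(w)` (`Phi4FlowSquareIntegrableSticking`) and the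
rejection-odds floor `r/(1 − r) ≥ b/Z − 1` (`IMHTauIntInfiniteOfWeightMoment.rejOdds_ge`); row 2's
`IMHSignObservableSandwich.imhOp_tauInt_ge_weightMean` is the bounded-class floor
`τ_int ≥ E_{g²}[b/Z] − ½`, which is NOT the comparison below (it lacks the `max(1, ·)`), and row 3's
`Scoring/IMHWeightBlindTauESS` compares chain and reweighting for WEIGHT-BLIND observables on a
finite product space.  Here: every square-integrable observable, general space, and the lattice.

## Setting (general measurable space `(X, μ)`, `μ` s-finite)

Target weight `w > 0` (`Z = ∫ w`, `π = w/Z`), model density `q > 0` with `∫ q = 1`, importance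
weight `b = w/q`; `K = imhOp μ w q` the exact flow sampler (propose from `q`, accept with
`min(1, b'/b)`); `r(x)` its rejection probability from `x`; for a measurable `g` with `∫ g² w < ∞`,
`A = ∫ g² w` and `τ_int(g) = tauInt (k ↦ ∫ g (Kᵏ g) w / A)`.  For CENTRED `g` (`∫ g w = 0`) the two
asymptotic variances per model draw are
* chain (ergodic average of the exact sampler): `σ²_chain(g) = 2 τ_int(g) · A/Z = 2 τ_int Var_π(g)`;
* reweighting (`Σ b(yᵢ) g(yᵢ) / Σ b(yᵢ)`, `yᵢ ∼ q` i.i.d.): `σ²_RW(g) = Z⁻² ∫ g² b w dμ = E_π[(b/Z) g²]`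
  (the sandwich variance of row 4's `Scoring/SelfNormalisedReweightingCLT`, `p = w/Z`).

## What is proved

* `rejectionOdds_ge_maxWeight` — pointwise `r/(1 − r) ≥ max(1, b/Z) − 1` (the odds are `≥ 0` AND
  `≥ b/Z − 1`);
* **`integral_sq_weight_maxWeight_le_of_sq`** — if the autocorrelation series of the square-integrable
  `g` is summable then `g² w · max(1, b/Z) ∈ L¹` and `∫ g² w max(1, b/Z) ≤ (τ_int(g) + ½) A`;
  **`imhOp_tauInt_ge_maxWeightMean_of_sq`** — the normalised form
  `τ_int(g) ≥ E_{g²}[max(1, b/Z)] − ½`;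
* **`imhOp_reweightVar_le_chainVar_of_sq`** — THE COMPARISON: a summable series forces
  `g² b w ∈ L¹` (the reweighting variance is finite — Deligiannidis–Lee's necessity direction) and
  `Z⁻² ∫ g² b w ≤ 2 τ_int(g) · A/Z`, i.e. **`σ²_RW(g) ≤ σ²_chain(g)`** (`b/Z ≤ 2 max(1, b/Z) − 1`);
* **`imhOp_reweightVar_le_chainVar`** — the bounded centred class under `W₂ = ∫ b w < ∞`:
  unconditional (the series is summable there, `IMHTauIntFiniteOfWeightMoment`);
* lattice φ⁴ (`Λ = Fin (n+1)`, every `λ > 0`, real `J`, EVERY positive model density `q̃` with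
  `∫ q̃ = 1`, `b = e^{−S}/q̃`): **`phi4Flow_reweightVar_le_chainVar_poly`** (every `f ∈ PolyObs` with a
  summable series: `Z⁻² ∫ (f − ⟨f⟩)² b e^{−S} ≤ 2 τ_int(f) Var(f)`), the magnetisation
  **`phi4Flow_reweightVar_le_chainVar_magnetisation`**, and the bounded class under `W₂ < ∞`
  **`phi4Flow_reweightVar_le_chainVar_bdd`** (no summability hypothesis).

Reading for S0-A (no numerics implied): per model draw (one network pass and one action evaluation
in both schemes), the large-`N` error bar of ANY square-integrable observable from the exact
flow-MCMC chain is never below the error bar of reweighting the same draws; when the chain's series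
is not summable the comparison is moot (its `N·variance` diverges, and so may `σ²_RW`).  The chain
never beats i.i.d. sampling from the target either (`τ_int ≥ ½`, tree), whereas reweighting can
(`σ²_RW(g) < Var_π(g)` when `g` lives where the model over-covers, `b < Z`) — there is NO converse
inequality at any constant.  What the accept/reject step buys is not variance: it is an unweighted,
exactly distributed configuration stream that composes with other exact updates (HMC, heat bath)
and needs no stored weights.  NOT CLAIMED: any value of `τ_int`, `σ²_RW`, ESS for any network or
run; finite-`N` statements (the reweighting estimator is biased at `O(1/N)`, the chain started off
equilibrium likewise); cost accounting beyond "per model draw"; anything for the HMC / local arms.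
-/

namespace Summit.Ventures.LatticeQCDFlow.Exactness

open Real MeasureTheory Filter Set Topology
open Summit.Ventures.LatticeQCDFlow.Scoring

/-! ## §1 General space: the odds floor with `max(1, b/Z)` and the comparison -/

section General

variable {X : Type*} [MeasurableSpace X] {μ : Measure X} {w q : X → ℝ}

variable [SFinite μ]

omit [SFinite μ] in
/-- **`r(x)/(1 − r(x)) ≥ max(1, b(x)/Z) − 1`**: the expected number of extra copies of the current
state is nonnegative and at least `b/Z − 1` (`rejOdds_ge`: the accepted mass from weight level `b`
is at most `Z/b`). -/
theorem rejectionOdds_ge_maxWeight (hw0 : ∀ t, 0 < w t) (hwm : Measurable w)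
    (hwi : Integrable w μ) (hq0 : ∀ t, 0 < q t) (hqm : Measurable q) (hqi : Integrable q μ)
    (hq1 : ∫ z, q z ∂μ = 1) (x : X) :
    max 1 (w x / q x / ∫ z, w z ∂μ) - 1
      ≤ (∫ z, (1 - imhAcceptQ w q x z) * q z ∂μ)
          / (1 - ∫ z, (1 - imhAcceptQ w q x z) * q z ∂μ) := by
  rw [rejection_eq_rejCurve hw0 hq0 x]
  have hb : 0 < w x / q x := div_pos (hw0 x) (hq0 x)
  rcases le_total (w x / q x / ∫ z, w z ∂μ) 1 with h | h
  · rw [max_eq_left h, sub_self]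
    obtain ⟨h0, h1⟩ := rejCurve_bounds (μ := μ) hw0 hq0 hqi hb
    rw [hq1] at h1
    exact div_nonneg h0 (sub_nonneg.2 h1)
  · rw [max_eq_right h]
    exact rejOdds_ge hw0 hwm hwi hq0 hqm hqi hq1 hb

/-- **`∫ g² w max(1, b/Z) ≤ (τ_int(g) + ½) ∫ g² w`** for every square-integrable `g` whose
autocorrelation series along the exact flow sampler is summable; the integrand is integrable
(dominated by `g² w (1 + r/(1 − r))`, integrable by the summed sticking floor). -/
theorem integral_sq_weight_maxWeight_le_of_sq (hw0 : ∀ t, 0 < w t) (hwm : Measurable w)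
    (hwi : Integrable w μ) (hq0 : ∀ t, 0 < q t) (hqm : Measurable q) (hqi : Integrable q μ)
    (hq1 : ∫ z, q z ∂μ = 1) {g : X → ℝ} (hgm : Measurable g)
    (hg2 : Integrable (fun t => g t ^ 2 * w t) μ)
    (hs : Summable fun n => (∫ x, g x * ((imhOp μ w q)^[n + 1] g) x * w x ∂μ)
      / ∫ x, g x ^ 2 * w x ∂μ) :
    Integrable (fun x => g x ^ 2 * w x * max 1 (w x / q x / ∫ z, w z ∂μ)) μ ∧
    ∫ x, g x ^ 2 * w x * max 1 (w x / q x / ∫ z, w z ∂μ) ∂μ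
      ≤ (tauInt (fun n => (∫ x, g x * ((imhOp μ w q)^[n] g) x * w x ∂μ) / ∫ x, g x ^ 2 * w x ∂μ)
          + 1 / 2) * ∫ x, g x ^ 2 * w x ∂μ := by
  obtain ⟨-, -, hrm⟩ := rejection_bounds (μ := μ) hw0 hwm hq0 hqm hqi hq1
  set r : X → ℝ := fun x => ∫ z, (1 - imhAcceptQ w q x z) * q z ∂μ with hr
  set Z : ℝ := ∫ z, w z ∂μ with hZdef
  set A := ∫ x, g x ^ 2 * w x ∂μ with hA
  obtain ⟨hoddsInt, hoddsLe⟩ :=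
    imhOp_integrable_stickingOdds_of_summable hw0 hwm hwi hq0 hqm hqi hq1 hgm hg2 hs
  have hgw0 : ∀ x, 0 ≤ g x ^ 2 * w x := fun x => mul_nonneg (sq_nonneg _) (hw0 x).le
  have hpt : ∀ x, max 1 (w x / q x / Z) - 1 ≤ r x / (1 - r x) := fun x =>
    rejectionOdds_ge_maxWeight hw0 hwm hwi hq0 hqm hqi hq1 x
  have hmxm : Measurable fun x => max 1 (w x / q x / Z) :=
    measurable_const.max ((hwm.div hqm).div_const Z)
  have hint1 : Integrable (fun x => g x ^ 2 * w x * (max 1 (w x / q x / Z) - 1)) μ := by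
    refine Integrable.mono' hoddsInt
      (((hgm.pow_const 2).mul hwm).mul (hmxm.sub measurable_const)).aestronglyMeasurable
      (Eventually.of_forall fun x => ?_)
    rw [Real.norm_eq_abs, abs_of_nonneg (mul_nonneg (hgw0 x) (sub_nonneg.2 (le_max_left _ _)))]
    exact mul_le_mul_of_nonneg_left (hpt x) (hgw0 x)
  have hint : Integrable (fun x => g x ^ 2 * w x * max 1 (w x / q x / Z)) μ := by
    refine (hint1.add hg2).congr (Eventually.of_forall fun x => ?_)
    simp only [Pi.add_apply]
    ring
  refine ⟨hint, ?_⟩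
  have h1 : ∫ x, g x ^ 2 * w x * (max 1 (w x / q x / Z) - 1) ∂μ
      ≤ ∫ x, g x ^ 2 * w x * (r x / (1 - r x)) ∂μ :=
    integral_mono hint1 hoddsInt fun x => mul_le_mul_of_nonneg_left (hpt x) (hgw0 x)
  have h2 : ∫ x, g x ^ 2 * w x * max 1 (w x / q x / Z) ∂μ
      = (∫ x, g x ^ 2 * w x * (max 1 (w x / q x / Z) - 1) ∂μ) + A := by
    rw [hA, ← integral_add hint1 hg2]
    refine integral_congr_ae (Eventually.of_forall fun x => ?_)
    ring
  rw [h2]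
  linarith [h1, hoddsLe]

/-- **`τ_int(g) ≥ E_{g²}[max(1, b/Z)] − ½`** — the `g²`-weighted mean of `max(1, b/Z)` (normalised
importance weight clipped from below at one) floors the integrated autocorrelation time of every
square-integrable `g` with a summable series. -/
theorem imhOp_tauInt_ge_maxWeightMean_of_sq (hw0 : ∀ t, 0 < w t) (hwm : Measurable w)
    (hwi : Integrable w μ) (hq0 : ∀ t, 0 < q t) (hqm : Measurable q) (hqi : Integrable q μ)
    (hq1 : ∫ z, q z ∂μ = 1) {g : X → ℝ} (hgm : Measurable g)
    (hg2 : Integrable (fun t => g t ^ 2 * w t) μ)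
    (hs : Summable fun n => (∫ x, g x * ((imhOp μ w q)^[n + 1] g) x * w x ∂μ)
      / ∫ x, g x ^ 2 * w x ∂μ) :
    (∫ x, g x ^ 2 * w x * max 1 (w x / q x / ∫ z, w z ∂μ) ∂μ) / (∫ x, g x ^ 2 * w x ∂μ) - 1 / 2
      ≤ tauInt (fun n => (∫ x, g x * ((imhOp μ w q)^[n] g) x * w x ∂μ)
          / ∫ x, g x ^ 2 * w x ∂μ) := by
  obtain ⟨-, hle⟩ := integral_sq_weight_maxWeight_le_of_sq hw0 hwm hwi hq0 hqm hqi hq1 hgm hg2 hs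
  have hA0 : 0 ≤ ∫ x, g x ^ 2 * w x ∂μ :=
    integral_nonneg fun x => mul_nonneg (sq_nonneg _) (hw0 x).le
  have hhalf := imhOp_tauInt_ge_stickingSum_of_sq hw0 hwm hwi hq0 hqm hqi hq1 hgm hg2 hs 0
  simp only [Finset.range_zero, Finset.sum_empty, add_zero] at hhalf
  set τ := tauInt (fun n => (∫ x, g x * ((imhOp μ w q)^[n] g) x * w x ∂μ)
    / ∫ x, g x ^ 2 * w x ∂μ) with hτ
  set A := ∫ x, g x ^ 2 * w x ∂μ with hA
  have key : (∫ x, g x ^ 2 * w x * max 1 (w x / q x / ∫ z, w z ∂μ) ∂μ) / A ≤ τ + 1 / 2 := by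
    rcases eq_or_lt_of_le hA0 with hz | hpos
    · rw [← hz, div_zero]
      linarith
    · rw [div_le_iff₀ hpos]
      exact hle
  linarith

/-- **THE COMPARISON `σ²_RW(g) ≤ σ²_chain(g)`.**  For every square-integrable `g` whose series along
the exact flow sampler is summable: `g² b w ∈ L¹(μ)` (the reweighting variance is finite) and
`Z⁻² ∫ g² b w dμ ≤ 2 τ_int(g) · (∫ g² w dμ)/Z` — for centred `g` the left side is the limiting
`N·variance` of the self-normalised reweighting estimator on `N` independent model draws and the
right side that of the ergodic average of the exact chain over `N` proposals. -/
theorem imhOp_reweightVar_le_chainVar_of_sq (hw0 : ∀ t, 0 < w t) (hwm : Measurable w)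
    (hwi : Integrable w μ) (hq0 : ∀ t, 0 < q t) (hqm : Measurable q) (hqi : Integrable q μ)
    (hq1 : ∫ z, q z ∂μ = 1) {g : X → ℝ} (hgm : Measurable g)
    (hg2 : Integrable (fun t => g t ^ 2 * w t) μ)
    (hs : Summable fun n => (∫ x, g x * ((imhOp μ w q)^[n + 1] g) x * w x ∂μ)
      / ∫ x, g x ^ 2 * w x ∂μ) :
    Integrable (fun x => g x ^ 2 * (w x / q x * w x)) μ ∧
    (∫ x, g x ^ 2 * (w x / q x * w x) ∂μ) / (∫ z, w z ∂μ) ^ 2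
      ≤ 2 * tauInt (fun n => (∫ x, g x * ((imhOp μ w q)^[n] g) x * w x ∂μ)
            / ∫ x, g x ^ 2 * w x ∂μ) * ((∫ x, g x ^ 2 * w x ∂μ) / ∫ z, w z ∂μ) := by
  obtain ⟨hint, hle⟩ := integral_sq_weight_maxWeight_le_of_sq hw0 hwm hwi hq0 hqm hqi hq1 hgm hg2 hs
  set Z : ℝ := ∫ z, w z ∂μ with hZdef
  set A := ∫ x, g x ^ 2 * w x ∂μ with hA
  set τ := tauInt (fun n => (∫ x, g x * ((imhOp μ w q)^[n] g) x * w x ∂μ) / A) with hτ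
  have hZ : 0 < Z := integral_pos_of_pos hw0 hwi hq1
  have hgw0 : ∀ x, 0 ≤ g x ^ 2 * w x := fun x => mul_nonneg (sq_nonneg _) (hw0 x).le
  -- pointwise: `g² b w ≤ Z · (2 g² w max(1, b/Z) − g² w)`
  have hpt : ∀ x, g x ^ 2 * (w x / q x * w x)
      ≤ Z * (2 * (g x ^ 2 * w x * max 1 (w x / q x / Z)) - g x ^ 2 * w x) := by
    intro x
    have hmax : w x / q x / Z ≤ 2 * max 1 (w x / q x / Z) - 1 := by
      rcases le_total 1 (w x / q x / Z) with h | h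
      · rw [max_eq_right h]; linarith
      · rw [max_eq_left h]; linarith
    have e : g x ^ 2 * (w x / q x * w x) = Z * (g x ^ 2 * w x * (w x / q x / Z)) := by
      field_simp
    rw [e]
    refine mul_le_mul_of_nonneg_left ?_ hZ.le
    have h := mul_le_mul_of_nonneg_left hmax (hgw0 x)
    linarith
  have hRint : Integrable (fun x => Z * (2 * (g x ^ 2 * w x * max 1 (w x / q x / Z))
      - g x ^ 2 * w x)) μ := ((hint.const_mul 2).sub hg2).const_mul Z
  have hLm : Measurable fun x => g x ^ 2 * (w x / q x * w x) :=
    (hgm.pow_const 2).mul ((hwm.div hqm).mul hwm)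
  have hL0 : ∀ x, 0 ≤ g x ^ 2 * (w x / q x * w x) := fun x =>
    mul_nonneg (sq_nonneg _) (mul_nonneg (div_pos (hw0 x) (hq0 x)).le (hw0 x).le)
  have hLint : Integrable (fun x => g x ^ 2 * (w x / q x * w x)) μ := by
    refine Integrable.mono' hRint hLm.aestronglyMeasurable (Eventually.of_forall fun x => ?_)
    rw [Real.norm_eq_abs, abs_of_nonneg (hL0 x)]
    exact hpt x
  refine ⟨hLint, ?_⟩
  have h1 : ∫ x, g x ^ 2 * (w x / q x * w x) ∂μ
      ≤ ∫ x, Z * (2 * (g x ^ 2 * w x * max 1 (w x / q x / Z)) - g x ^ 2 * w x) ∂μ :=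
    integral_mono hLint hRint hpt
  have h2 : ∫ x, Z * (2 * (g x ^ 2 * w x * max 1 (w x / q x / Z)) - g x ^ 2 * w x) ∂μ
      = Z * (2 * (∫ x, g x ^ 2 * w x * max 1 (w x / q x / Z) ∂μ) - A) := by
    rw [integral_const_mul, integral_sub (hint.const_mul 2) hg2, integral_const_mul]
  rw [h2] at h1
  have h3 : ∫ x, g x ^ 2 * (w x / q x * w x) ∂μ ≤ 2 * τ * A * Z := by
    have := mul_le_mul_of_nonneg_left hle (by norm_num : (0:ℝ) ≤ 2)
    nlinarith [h1, this, hZ]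
  rw [div_le_iff₀ (pow_pos hZ 2)]
  have e : 2 * τ * (A / Z) * Z ^ 2 = 2 * τ * A * Z := by
    field_simp
  rw [e]
  exact h3

/-- **`σ²_RW(g) ≤ σ²_chain(g)` on the bounded centred class under `W₂ < ∞`, unconditionally** — the
series is summable there (`summable_autocov_of_weightMoment`): for every bounded measurable
centred `g`, `Z⁻² ∫ g² b w ≤ 2 τ_int(g) · (∫ g² w)/Z`. -/
theorem imhOp_reweightVar_le_chainVar (hw0 : ∀ t, 0 < w t) (hwm : Measurable w)
    (hwi : Integrable w μ) (hq0 : ∀ t, 0 < q t) (hqm : Measurable q) (hqi : Integrable q μ)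
    (hq1 : ∫ z, q z ∂μ = 1) (hW₂ : Integrable (fun x => w x / q x * w x) μ) {g : X → ℝ}
    (hgm : Measurable g) {B : ℝ} (hgb : ∀ t, |g t| ≤ B) (hg0 : ∫ x, g x * w x ∂μ = 0) :
    (∫ x, g x ^ 2 * (w x / q x * w x) ∂μ) / (∫ z, w z ∂μ) ^ 2
      ≤ 2 * tauInt (fun n => (∫ x, g x * ((imhOp μ w q)^[n] g) x * w x ∂μ)
            / ∫ x, g x ^ 2 * w x ∂μ) * ((∫ x, g x ^ 2 * w x ∂μ) / ∫ z, w z ∂μ) := by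
  have hS := summable_autocov_of_weightMoment hw0 hwm hwi hq0 hqm hqi hq1 hW₂ hgm hgb hg0
  exact (imhOp_reweightVar_le_chainVar_of_sq hw0 hwm hwi hq0 hqm hqi hq1 hgm
    (sq_integrable_of_bdd (fun t => (hw0 t).le) hwm hwi hgm hgb)
    (hS.div_const (∫ x, g x ^ 2 * w x ∂μ))).2

end General

/-! ## §2 Lattice φ⁴: every polynomial observable, the magnetisation, the bounded class -/

section Lattice

variable {n : ℕ}

/-- **`σ²_RW(f) ≤ σ²_chain(f)` FOR EVERY POLYNOMIAL OBSERVABLE OF LATTICE φ⁴** (`λ > 0`, real `J`,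
EVERY positive model density `q̃` with `∫ q̃ = 1`, `b = e^{−S}/q̃`): if the series of
`f ∈ PolyObs` along the exact flow sampler is summable, then `(f − ⟨f⟩)² b e^{−S}` is integrable
and `Z⁻² ∫ (f − ⟨f⟩)² b e^{−S} dφ ≤ 2 τ_int(f) · Var(f)` (`Var(f) = ⟨(f − ⟨f⟩)²⟩`): reweighting
the flow's draws is never less efficient, per draw, than the ergodic average of the exact chain. -/
theorem phi4Flow_reweightVar_le_chainVar_poly {lam : ℝ} (hlam : 0 < lam)
    (J : Fin (n + 1) → Fin (n + 1) → ℝ) {q : (Fin (n + 1) → ℝ) → ℝ} (hq0 : ∀ φ, 0 < q φ)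
    (hqm : Measurable q) (hqi : Integrable q) (hq1 : ∫ φ, q φ = 1) {f : (Fin (n + 1) → ℝ) → ℝ}
    (hf : PolyObs f)
    (hs : Summable fun k => (∫ φ, (f φ - gibbsExpect J lam f)
        * ((imhOpPhi4 J lam q)^[k + 1] (fun ψ => f ψ - gibbsExpect J lam f)) φ * gibbsWeight J lam φ)
        / ∫ φ, (f φ - gibbsExpect J lam f) ^ 2 * gibbsWeight J lam φ) :
    Integrable (fun φ => (f φ - gibbsExpect J lam f) ^ 2
        * (gibbsWeight J lam φ / q φ * gibbsWeight J lam φ)) ∧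
    (∫ φ, (f φ - gibbsExpect J lam f) ^ 2 * (gibbsWeight J lam φ / q φ * gibbsWeight J lam φ))
        / gibbsZ J lam ^ 2
      ≤ 2 * tauInt (fun k => (∫ φ, (f φ - gibbsExpect J lam f)
            * ((imhOpPhi4 J lam q)^[k] (fun ψ => f ψ - gibbsExpect J lam f)) φ * gibbsWeight J lam φ)
            / ∫ φ, (f φ - gibbsExpect J lam f) ^ 2 * gibbsWeight J lam φ)
          * gibbsExpect J lam (fun φ => (f φ - gibbsExpect J lam f) ^ 2) := by
  obtain ⟨hgm, hg2⟩ := polyObs_sq_integrable hlam J (polyObs_sub_const hf (gibbsExpect J lam f))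
  rw [imhOpPhi4_eq_imhOp] at hs ⊢
  exact imhOp_reweightVar_le_chainVar_of_sq (μ := volume) (fun φ => gibbsWeight_pos J lam φ)
    (continuous_gibbsWeight J lam).measurable (integrable_gibbsWeight hlam J) hq0 hqm hqi hq1 hgm hg2
    hs

/-- **THE MAGNETISATION**: a summable series for `M = Σ_x φ_x` under the flow arm forces
`Z⁻² ∫ M̃² b e^{−S} ≤ 2 τ_int(M) · Var(M)` (`M̃ = M − ⟨M⟩`), every network. -/
theorem phi4Flow_reweightVar_le_chainVar_magnetisation {lam : ℝ} (hlam : 0 < lam)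
    (J : Fin (n + 1) → Fin (n + 1) → ℝ) {q : (Fin (n + 1) → ℝ) → ℝ} (hq0 : ∀ φ, 0 < q φ)
    (hqm : Measurable q) (hqi : Integrable q) (hq1 : ∫ φ, q φ = 1)
    (hs : Summable fun k => (∫ φ, ((∑ x, φ x) - gibbsExpect J lam (fun ψ => ∑ x, ψ x))
        * ((imhOpPhi4 J lam q)^[k + 1]
            (fun ψ => (∑ x, ψ x) - gibbsExpect J lam (fun ψ => ∑ x, ψ x))) φ * gibbsWeight J lam φ)
        / ∫ φ, ((∑ x, φ x) - gibbsExpect J lam (fun ψ => ∑ x, ψ x)) ^ 2 * gibbsWeight J lam φ) :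
    (∫ φ, ((∑ x, φ x) - gibbsExpect J lam (fun ψ => ∑ x, ψ x)) ^ 2
          * (gibbsWeight J lam φ / q φ * gibbsWeight J lam φ)) / gibbsZ J lam ^ 2
      ≤ 2 * tauInt (fun k => (∫ φ, ((∑ x, φ x) - gibbsExpect J lam (fun ψ => ∑ x, ψ x))
            * ((imhOpPhi4 J lam q)^[k]
                (fun ψ => (∑ x, ψ x) - gibbsExpect J lam (fun ψ => ∑ x, ψ x))) φ * gibbsWeight J lam φ)
            / ∫ φ, ((∑ x, φ x) - gibbsExpect J lam (fun ψ => ∑ x, ψ x)) ^ 2 * gibbsWeight J lam φ)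
          * gibbsExpect J lam (fun φ => ((∑ x, φ x) - gibbsExpect J lam (fun ψ => ∑ x, ψ x)) ^ 2) :=
  (phi4Flow_reweightVar_le_chainVar_poly hlam J hq0 hqm hqi hq1 polyObs_magnetisation hs).2

/-- **THE BOUNDED CLASS, UNCONDITIONALLY UNDER `W₂ < ∞`**: for every bounded measurable `f` and every
flow with `∫ e^{−S} (e^{−S}/q̃) < ∞`: `Z⁻² ∫ (f − ⟨f⟩)² b e^{−S} ≤ 2 τ_int(f) · Var(f)`. -/
theorem phi4Flow_reweightVar_le_chainVar_bdd {lam : ℝ} (hlam : 0 < lam)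
    (J : Fin (n + 1) → Fin (n + 1) → ℝ) {q : (Fin (n + 1) → ℝ) → ℝ} (hq0 : ∀ φ, 0 < q φ)
    (hqm : Measurable q) (hqi : Integrable q) (hq1 : ∫ φ, q φ = 1)
    (hW₂ : Integrable (fun φ => gibbsWeight J lam φ / q φ * gibbsWeight J lam φ))
    {f : (Fin (n + 1) → ℝ) → ℝ} (hfm : Measurable f) {B : ℝ} (hfb : ∀ φ, |f φ| ≤ B) :
    (∫ φ, (f φ - gibbsExpect J lam f) ^ 2 * (gibbsWeight J lam φ / q φ * gibbsWeight J lam φ))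
        / gibbsZ J lam ^ 2
      ≤ 2 * tauInt (fun k => (∫ φ, (f φ - gibbsExpect J lam f)
            * ((imhOpPhi4 J lam q)^[k] (fun ψ => f ψ - gibbsExpect J lam f)) φ * gibbsWeight J lam φ)
            / ∫ φ, (f φ - gibbsExpect J lam f) ^ 2 * gibbsWeight J lam φ)
          * gibbsExpect J lam (fun φ => (f φ - gibbsExpect J lam f) ^ 2) := by
  obtain ⟨hgm, hgb, hg0⟩ := centred_observable hlam J hfm hfb
  rw [imhOpPhi4_eq_imhOp]
  exact imhOp_reweightVar_le_chainVar (μ := volume) (fun φ => gibbsWeight_pos J lam φ)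
    (continuous_gibbsWeight J lam).measurable (integrable_gibbsWeight hlam J) hq0 hqm hqi hq1 hW₂
    hgm hgb hg0

end Lattice

end Summit.Ventures.LatticeQCDFlow.Exactness
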